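import Literature.Topology.Immersions.ProjectionFieldBundle
import Mathlib.Analysis.InnerProductSpace.Projection.FiniteDimensional
import HarnessLib

/-!
# The orthogonal complement of a projection-field bundle

Topic `Literature/Topology/Immersions`. For a rank-`k` bundle `E = E(P)` in `M × ℝᵐ` given by a
smooth field of orthogonal projections (`ProjectionFieldBundle.lean`), the field `x ↦ 1 - P_x`
is again a smooth field of orthogonal projections, of rank `m - k`: the **orthogonal complement
bundle** `E^⊥` with `E ⊕ E^⊥ = M × ℝᵐ` (Milnor–Stasheff, *Characteristic Classes* (1974), §3
Thm. 3.3: "`ξ ⊕ ξ^⊥` is the trivial bundle"; the normal bundle of `NormalProjBundle.lean` is the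
case `E = df(TM)`).

* `ProjBundle.compl P hk : ProjBundle n m k' M` (`k + k' = m`), `compl_proj`;
* `ProjBundle.fibre_compl` — `E^⊥_x = (E_x)ᗮ`; `ProjBundle.proj_apply_eq_zero_iff` —
  `P_x v = 0 ↔ v ∈ E^⊥_x`; `ProjBundle.eq_zero_of_mem_fibre_of_mem_fibre_compl`.

Everything here is proved; no named facts are introduced.

## References

* J. Milnor, J. Stasheff, *Characteristic Classes* (1974), §3 Thm. 3.3. [MilnorStasheff1974]
-/

open scoped Manifold ContDiff Topology RealInnerProductSpace
open Set Function Module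

noncomputable section

namespace Literature.Topology.Immersions

/-- Local notation: `𝔼 n` is the model Euclidean space `EuclideanSpace ℝ (Fin n)`. -/
local notation "𝔼 " n:arg => EuclideanSpace ℝ (Fin n)

namespace ProjBundle

variable {n m k k' : ℕ} {M : Type*} [TopologicalSpace M] [ChartedSpace (𝔼 n) M]
  (P : ProjBundle n m k M)

/-- `P_x v = 0` iff `v` is orthogonal to the fibre `E_x`. [folklore] -/
theorem proj_apply_eq_zero_iff (x : M) (v : 𝔼 m) : P.proj x v = 0 ↔ v ∈ (P.fibre x)ᗮ := by
  constructor
  · intro hv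
    rw [Submodule.mem_orthogonal]
    rintro u ⟨w, rfl⟩
    show ⟪P.proj x w, v⟫ = 0
    rw [P.inner_proj_comm, hv, inner_zero_right]
  · intro hv
    have h1 : ⟪P.proj x v, P.proj x v⟫ = 0 := by
      rw [← P.inner_proj_comm, P.proj_proj]
      exact (Submodule.inner_right_of_mem_orthogonal (P.proj_mem_fibre x v) hv)
    exact inner_self_eq_zero.1 h1

/-- The range of `1 - P_x` is the orthogonal complement of the fibre. [folklore] -/
theorem range_one_sub_proj (x : M) :
    LinearMap.range (ContinuousLinearMap.id ℝ (𝔼 m) - P.proj x).toLinearMap = (P.fibre x)ᗮ := by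
  ext v
  constructor
  · rintro ⟨w, rfl⟩
    rw [← P.proj_apply_eq_zero_iff]
    show P.proj x (w - P.proj x w) = 0
    rw [map_sub, P.proj_proj, sub_self]
  · intro hv
    refine ⟨v, ?_⟩
    show v - P.proj x v = v
    rw [(P.proj_apply_eq_zero_iff x v).2 hv, sub_zero]

/-- **The orthogonal complement bundle `E^⊥`**: the projection field `x ↦ 1 - P_x`, of rank
`k' = m - k`. [cite: MilnorStasheff1974, §3 Thm. 3.3] -/
def compl (hk : k + k' = m) : ProjBundle n m k' M where
  proj x := ContinuousLinearMap.id ℝ (𝔼 m) - P.proj x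
  contMDiff_proj' := contMDiff_const.sub P.contMDiff_proj'
  proj_proj x v := by
    show (v - P.proj x v) - P.proj x (v - P.proj x v) = v - P.proj x v
    rw [map_sub, P.proj_proj, sub_self, sub_zero]
  inner_proj_comm x v w := by
    show ⟪v - P.proj x v, w⟫ = ⟪v, w - P.proj x w⟫
    rw [inner_sub_left, inner_sub_right, P.inner_proj_comm]
  finrank_range x := by
    rw [P.range_one_sub_proj]
    have h := Submodule.finrank_add_finrank_orthogonal (P.fibre x)
    rw [finrank_euclideanSpace_fin] at h
    have hk' : finrank ℝ (P.fibre x) = k := P.finrank_range x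
    omega

/-- The projections of the complement bundle. [folklore] -/
@[simp] theorem compl_proj (hk : k + k' = m) (x : M) :
    (P.compl hk).proj x = ContinuousLinearMap.id ℝ (𝔼 m) - P.proj x := rfl

/-- The projections of the complement bundle, applied. [folklore] -/
theorem compl_proj_apply (hk : k + k' = m) (x : M) (v : 𝔼 m) :
    (P.compl hk).proj x v = v - P.proj x v := rfl

/-- **`E^⊥_x = (E_x)ᗮ`.** [cite: MilnorStasheff1974, §3 Thm. 3.3] -/
theorem fibre_compl (hk : k + k' = m) (x : M) : (P.compl hk).fibre x = (P.fibre x)ᗮ :=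
  P.range_one_sub_proj x

/-- `P_x + (1 - P_x) = 1`. [folklore] -/
theorem proj_add_compl_proj (hk : k + k' = m) (x : M) (v : 𝔼 m) :
    P.proj x v + (P.compl hk).proj x v = v := by
  rw [compl_proj_apply]
  abel

/-- A vector lying in both `E_x` and `E^⊥_x` vanishes. [folklore] -/
theorem eq_zero_of_mem_fibre_of_mem_fibre_compl (hk : k + k' = m) (x : M) {v : 𝔼 m}
    (h1 : v ∈ P.fibre x) (h2 : v ∈ (P.compl hk).fibre x) : v = 0 := by
  rw [fibre_compl] at h2
  have h : v ∈ P.fibre x ⊓ (P.fibre x)ᗮ := ⟨h1, h2⟩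
  rwa [Submodule.inf_orthogonal_eq_bot, Submodule.mem_bot] at h

end ProjBundle

end Literature.Topology.Immersions
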